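import Summits.KontsevichZagierPeriods.KontsevichZagierPeriods.Theses.AyoubSpecialisation

/-!
# `TargetGlue` (stmt-KontsevichZagierPeriods-14210, route AyoubSpecialisation) — proof

`TargetGlue : PiProductRep → AyoubPiCancellation → AyoubPiLocalKernel → AyoubThesisV2`
(route-choice repair 2026-08-16, option (a)): the pinned product `P n r = [π] ⋆ r : IntegralRep (n+2)`
(`PiProductRep`) together with the two cruxes — `π`-cancellation and the `π`-localised kernel, both
stated for every pinned `P` — give the bundled rank-0 target `AyoubThesisV2`, which is literally
`∃ P, pinned P ∧ (π-local kernel for P) ∧ (π-cancellation for P)`. Pure logic over the route's own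
definitions, no analysis, no new definitions: destructure `PiProductRep`, feed its `P` and pinning
equations to both cruxes. Planner-proved glue (item docstring), landed by lead c10 of crux
stmt-KontsevichZagierPeriods-9129 (banking). Sources: M. Kontsevich, D. Zagier, *Periods* (2001) §4.1;
A. Huber, S. Müller-Stach, *Periods and Nori motives* (2017) §13.1.
-/

namespace Summit.KontsevichZagierPeriods.AyoubSpecialisation

/-- **`TargetGlue`** (route AyoubSpecialisation, stmt-KontsevichZagierPeriods-14210):
`PiProductRep → AyoubPiCancellation → AyoubPiLocalKernel → AyoubThesisV2` — the pinned disc-product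
family `P` of `PiProductRep` witnesses the existential of `AyoubThesisV2`, its second conjunct is the
`π`-local kernel crux at `P` and its third the `π`-cancellation crux at `P`. One destructuring and one
anonymous constructor. [folklore] -/
theorem targetGlue_proof :
    Summit.KontsevichZagierPeriods.KontsevichZagierPeriods.Theses.AyoubSpecialisation.TargetGlue := by
  rintro ⟨P, hPin⟩ h₂ h₃
  exact ⟨P, hPin, h₃ P hPin, h₂ P hPin⟩

end Summit.KontsevichZagierPeriods.AyoubSpecialisation
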